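import Summits.HubbardSuperconductivity.HubbardSuperconductivity.Theorems.ParentFirstSMAMottGap

/-!
# Stub `stub_parentMottGapWindow_of_holeSingleMode` (S1) of line `birth`
# (crux `BoundCoherentDWavePairs`, item stmt-HubbardSuperconductivity-10770, route `ParentFirstSMA`)

The parent Mott gap on the window `12 ≤ U ≤ 24` (stub G of the line, verbatim hypothesis (a) of
crux #4 `DiluteDWavePairsCondense`) follows from crux #2 `HoleSingleModeBelowHalfU` BY NAME and the
landed support `mottGapFromSingleMode_proof` (`Z·(U − Δ_c(L)) ≤ 2f` for even `L ≥ 2`): crux #2 gives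
`ε > 0`, `L₀` and, for every even `L ≥ L₀`, a one-hole ground state `φ` and a momentum `k` with
`0 < Z` and `2f ≤ (U − ε)·Z`; hence `ε ≤ Δ_c(L)` for even `L ≥ max L₀ 2`. This is the first half of
the route's deciding theorem `closes`, isolated so that the line's stub G is visibly
"crux #2 + proved glue".

No definitions are introduced.
-/

-- the mandated namespace `Summit.<Summit>.<Problem>.Theorems` repeats `HubbardSuperconductivity`
set_option linter.dupNamespace false

noncomputable section

namespace Summit.HubbardSuperconductivity.HubbardSuperconductivity.Theorems.ParentFirstSMA

open Literature.MathematicalPhysics.QuantumLattice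
open Summit.HubbardSuperconductivity.HubbardSuperconductivity.Theses.ParentFirstSMA

/-- **Stub S1 of line `birth` (crux `BoundCoherentDWavePairs`, stmt-HubbardSuperconductivity-10770):
the parent Mott gap on the window from crux #2.** `HoleSingleModeBelowHalfU` implies: for every
`U ∈ [12, 24]` there are `g > 0` and `L₀` with `g ≤ chargeGap (fermionTorusGraph 2 L) 1 U (L²)` for
all even `L ≥ L₀` — by `mottGapFromSingleMode_proof` (`Z(U − Δ_c) ≤ 2f`) and `0 < Z`,
`2f ≤ (U − ε)Z`. [cite: LiebWuPhysicaA2003, §1 eq. (3)] -/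
theorem stub_parentMottGapWindow_of_holeSingleMode :
    HoleSingleModeBelowHalfU →
      ∀ U : ℝ, 12 ≤ U → U ≤ 24 → ∃ g : ℝ, 0 < g ∧ ∃ L₀ : ℕ, ∀ L : ℕ, L₀ ≤ L → Even L →
        g ≤ chargeGap (fermionTorusGraph 2 L) 1 U (L ^ 2) := by
  intro h₁ U hU12 hU24
  obtain ⟨ε, hε, L₀, hL⟩ := h₁ U hU12 hU24
  have key : ∀ {Z f Δ U' ε' : ℝ}, 0 < Z → 2 * f ≤ (U' - ε') * Z → Z * (U' - Δ) ≤ 2 * f →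
      ε' ≤ Δ := by
    intro Z f Δ U' ε' hZ hf hm
    nlinarith
  refine ⟨ε, hε, max L₀ 2, fun L hL' hLeven => ?_⟩
  obtain ⟨k, φ, hgs, -, hZpos, hf⟩ := hL L (le_trans (le_max_left _ _) hL') hLeven
  exact key hZpos hf
    (mottGapFromSingleMode_proof U L k φ hLeven (le_trans (le_max_right _ _) hL') hgs)

end Summit.HubbardSuperconductivity.HubbardSuperconductivity.Theorems.ParentFirstSMA

end
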